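import Literature.NumberTheory.LFunctions.WeilTwoPrimeCertificate
import HarnessLib

/-!
# The deflated (rank-one augmented) two-prime certificate format and its soundness

Topic `Literature/NumberTheory/LFunctions`, companion of `WeilTwoPrimeCertificate.lean` (Yoshida's moment format `WeilCert23`
for the two-prime analytic form `E₂₃ = weilTwoPrimeQuadratic`).  Purpose: the LOW-PRECISION COMPLEMENT CERTIFICATE `(β)` of the
deflated Temple / Lehmann–Maehly L-side (`Summits/RiemannHypothesis/RiemannHypothesis/Theorems/GroundBartaEvenWinsBeyondArch
Deflation{Bound,Ritz}.lean`, hypothesis `hcert`):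

  `β ‖g‖₂² ≤ E₂₃(g) + Σ_i μ_i |Σ_k ĉ_{ik} M_k(g)|²`   for every test `g` on `C(b)`,

where `M_k(g) = weilMoment a₀ g k = ∫ g(x) (x/a₀)^k dx` are the scaled moments, so that `Σ_k ĉ_{ik} M_k(g) = ∫ g · v_i` for the
polynomial trial vector `v_i(x) = Σ_k ĉ_{ik} (x/a₀)^k` on the window (the rank-one "deflation" terms of the Ritz vectors), and
`ĉ_{ik}` is the parity-masked coefficient table (`maskV`).  Mechanism = the existing chain verbatim
(`WeilCert23.margin_step3`: `Σ P_r(k,l) Re(M̄_k M_l) + κ‖g‖² ≤ E₂₃(g)`; Bessel `‖g‖² ≥ 2Re⟨u,g⟩ − ‖u‖²`; block positivity), with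
two changes: the Bessel step is run with `κ' = κ − β ≥ 0` (the remaining `β‖g‖²` is the claim), and the checked block matrix is
`S' = Dᵀ(P_r + Σ_i μ_i ĉ_i ĉ_iᵀ)D + κ'(2 diag b − (bbᵀ)∘H')` — the rank-one terms make the form positive on the low modes that
`P_r` alone (true bottom `ε(c) ≈ 1e-12`) cannot certify at level `β ≈ 0.3`.

* `WeilCert.pdBlkP/spBlkP/rBlkP/checkBlockP/spFunP`, `block_identityP`, `core_nonnegP` — the block machinery of
  `WeilFirstPrimeCertificate.lean` (`…K` family) re-stated for an ARBITRARY parity-diagonal coefficient matrix `P` in place of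
  `P_r = prQ nu` (proofs verbatim);
* `rankOneQ`, `maskV`, `core_nonnegR` — `P := P_r + Σ μ ĉ ĉᵀ` and the identity `Σ_{kl} ĉ_k ĉ_l Re(M̄_k M_l) = |Σ ĉ_k M_k|²`;
* `WeilCert23.checkR`, **`WeilCert23.weilTwoPrimeQuadratic_rankOne_bound_of_checkR`** — the checker and its soundness.

All proved; no named facts.  (Prover B gen 3, GroundBarta rung 4; A's HANDOFF §farm goal G2, Lean side.  The generator — cells
with `wL ≥ log π + β + …`, i.e. `T ≈ 90–120`, low precision; the augmented block; its factor `U` — is the compute side.)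

## References
* H. Yoshida, *On Hermitian forms attached to zeta functions*, Adv. Stud. Pure Math. 21 (1992), §2, §6, Thm 1. [Yoshida1992]
* A. Weinstein, W. Stenger, *Methods of Intermediate Problems for Eigenvalues* (1972), Ch. 5 §9. [WeinsteinStenger1972]
-/

noncomputable section

open Complex Finset MeasureTheory Set Filter
open scoped Real Topology ComplexConjugate BigOperators

namespace Literature.NumberTheory.LFunctions

open Literature.Analysis.ValidatedNumerics.Numerics
open Literature.Analysis.SpecialFunctions

/-! ## The block machinery of `WeilCert` for an arbitrary parity-diagonal coefficient matrix `P` -/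

namespace WeilCert

variable (c : WeilCert)

/-- `P D` for an arbitrary coefficient matrix `P` (in the archimedean/two-prime certificates `P = P_r = prQ nu`;
here `P` may carry additional rank-one terms), materialized on the parity block `p`. [folklore] -/
def pdBlkP (P : ℕ → ℕ → ℚ) (p : ℕ) : List (List ℚ) :=
  tabM c.nb fun k j ↦ sumR c.nb fun l ↦ P (2 * k + p) (2 * l + p) * getM (c.Db p) l j

/-- Entries of `P D`. [folklore] -/
theorem getM_pdBlkP (P : ℕ → ℕ → ℚ) (p : ℕ) {k j : ℕ} (hk : k < c.nb) (hj : j < c.nb) :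
    getM (c.pdBlkP P p) k j = ∑ l ∈ range c.nb, P (2 * k + p) (2 * l + p) * getM (c.Db p) l j := by
  unfold pdBlkP
  rw [getM_tabM _ hk hj, sumR_eq_sum]

/-- `S' = Dᵀ P D + κ (2 diag b − (b bᵀ) ∘ H')` for an arbitrary `P`, materialized. [folklore] -/
def spBlkP (P : ℕ → ℕ → ℚ) (κ : ℚ) (p : ℕ) : List (List ℚ) :=
  let pd := c.pdBlkP P p
  let hp := c.hpBlk p
  tabM c.nb fun i j ↦
    (sumR c.nb fun k ↦ getM (c.Db p) k i * getM pd k j) +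
      κ * ((if i = j then 2 * c.bQ p i else 0) - c.bQ p i * c.bQ p j * getM hp i j)

/-- `R = S' − Uᵀ U`, materialized. [folklore] -/
def rBlkP (P : ℕ → ℕ → ℚ) (κ : ℚ) (p : ℕ) : List (List ℚ) :=
  let sp := c.spBlkP P κ p
  tabM c.nb fun i j ↦ getM sp i j - sumR c.nb fun k ↦ getM (c.Ub p) k i * getM (c.Ub p) k j

/-- All checks of the parity block `p`. [folklore] -/
def checkBlockP (P : ℕ → ℕ → ℚ) (κ : ℚ) (p : ℕ) : Bool :=
  c.checkDC p && checkDom c.nb (c.rBlkP P κ p)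


section TablesP

variable (P : ℕ → ℕ → ℚ) (p : ℕ)

/-- Entries of the materialized `S'`. [folklore] -/
theorem getM_spBlkP (κ : ℚ) {i j : ℕ} (hi : i < c.nb) (hj : j < c.nb) :
    getM (c.spBlkP P κ p) i j =
      (∑ k ∈ range c.nb, getM (c.Db p) k i *
          ∑ l ∈ range c.nb, P (2 * k + p) (2 * l + p) * getM (c.Db p) l j) +
        κ * ((if i = j then 2 * c.bQ p i else 0) - c.bQ p i * c.bQ p j * getM (c.hpBlk p) i j) := by
  unfold spBlkP
  dsimp only
  rw [getM_tabM _ hi hj, sumR_eq_sum]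
  congr 1
  exact Finset.sum_congr rfl fun k hk ↦ by rw [c.getM_pdBlkP P p (Finset.mem_range.1 hk) hj]

/-- Entries of the materialized `R = S' − UᵀU`. [folklore] -/
theorem getM_rBlkP (κ : ℚ) {i j : ℕ} (hi : i < c.nb) (hj : j < c.nb) :
    getM (c.rBlkP P κ p) i j =
      getM (c.spBlkP P κ p) i j - ∑ k ∈ range c.nb, getM (c.Ub p) k i * getM (c.Ub p) k j := by
  unfold rBlkP
  dsimp only
  rw [getM_tabM _ hi hj, sumR_eq_sum]


end TablesP

variable {c}

/-! ### The algebraic core: per-parity reduction and positivity -/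

/-- The real block matrix `S'_p` as a function. [folklore] -/
def spFunP (c : WeilCert) (P : ℕ → ℕ → ℚ) (κ : ℚ) (p : ℕ) (j j' : ℕ) : ℝ := (getM (c.spBlkP P κ p) j j' : ℝ)

/-- **Block positivity** from the dominance check. [folklore] -/
theorem spFunP_quad_nonneg {P : ℕ → ℕ → ℚ} {κ : ℚ} {p : ℕ} (h : c.checkBlockP P κ p = true) (x : ℕ → ℝ) :
    0 ≤ ∑ i ∈ range c.nb, ∑ j ∈ range c.nb, spFunP c P κ p i j * (x i * x j) := by
  unfold checkBlockP at h
  rw [Bool.and_eq_true] at h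
  have hdom := h.2
  set R : ℕ → ℕ → ℝ := fun i j ↦ (getM (c.rBlkP P κ p) i j : ℝ) with hR
  set U : ℕ → ℕ → ℝ := fun i j ↦ (getM (c.Ub p) i j : ℝ) with hU
  have hsplit : ∀ i ∈ range c.nb, ∀ j ∈ range c.nb,
      spFunP c P κ p i j = R i j + ∑ k ∈ range c.nb, U k i * U k j := by
    intro i hi j hj
    rw [hR, hU, spFunP]
    simp only
    rw [c.getM_rBlkP P p κ (Finset.mem_range.1 hi) (Finset.mem_range.1 hj)]
    push_cast
    ring
  have h1 : ∑ i ∈ range c.nb, ∑ j ∈ range c.nb, spFunP c P κ p i j * (x i * x j) =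
      ∑ i ∈ range c.nb, ∑ j ∈ range c.nb, R i j * (x i * x j) +
        ∑ i ∈ range c.nb, ∑ j ∈ range c.nb, (∑ k ∈ range c.nb, U k i * U k j) * (x i * x j) := by
    rw [← Finset.sum_add_distrib]
    refine Finset.sum_congr rfl fun i hi ↦ ?_
    rw [← Finset.sum_add_distrib]
    refine Finset.sum_congr rfl fun j hj ↦ ?_
    rw [hsplit i hi j hj]
    ring
  rw [h1]
  refine add_nonneg (WeilAlg.quad_nonneg_of_dominant c.nb R (fun i hi ↦ ?_) x)
    (WeilAlg.quad_gram_nonneg c.nb U x)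
  have hd := of_checkDom hdom (Finset.mem_range.1 hi)
  rw [hR]
  simp only
  have : ∑ j ∈ range c.nb, (if j = i then (0 : ℝ) else
      (|((getM (c.rBlkP P κ p) i j : ℚ) : ℝ)| + |((getM (c.rBlkP P κ p) j i : ℚ) : ℝ)|) / 2) =
      ((∑ j ∈ range c.nb, (if j = i then (0 : ℚ) else
        (|getM (c.rBlkP P κ p) i j| + |getM (c.rBlkP P κ p) j i|) / 2) : ℚ) : ℝ) := by
    push_cast
    refine Finset.sum_congr rfl fun j _ ↦ ?_
    split_ifs <;> simp
  rw [this]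
  exact_mod_cast hd

/-- **Per-parity identity.** The block contributions equal `Re y* S'_p y`. [folklore] -/
theorem block_identityP {P : ℕ → ℕ → ℚ} (κ : ℚ) {p : ℕ} (hp : p < 2) (hDC : c.checkDC p = true) (M : ℕ → ℂ) :
    (∑ i ∈ range c.nb, ∑ i' ∈ range c.nb,
        (P (2 * i + p) (2 * i' + p) : ℂ) * (conj (M (2 * i + p)) * M (2 * i' + p))) +
      (κ : ℂ) *
        (2 * ∑ i ∈ range c.nb, conj (c.uVec M (2 * i + p)) * M (2 * i + p) -
          ∑ i ∈ range c.nb, ∑ i' ∈ range c.nb,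
            conj (c.uVec M (2 * i + p)) * c.uVec M (2 * i' + p) * (c.hBlkQ p i i' : ℂ)) =
      ∑ j ∈ range c.nb, ∑ j' ∈ range c.nb,
        (spFunP c P κ p j j' : ℂ) * (conj (c.yVec M p j) * c.yVec M p j') := by
  set nb := c.nb with hnb
  set y : ℕ → ℂ := c.yVec M p with hy
  set D : ℕ → ℕ → ℝ := fun i j ↦ (getM (c.Db p) i j : ℝ) with hD
  set C : ℕ → ℕ → ℝ := fun i j ↦ (getM (c.Cb p) i j : ℝ) with hC
  set b : ℕ → ℝ := fun j ↦ (c.bQ p j : ℝ) with hb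
  -- (1) retraction: M(2i+p) = Σ_j D i j y j
  have hDC' : ∀ i ∈ range nb, ∀ i' ∈ range nb,
      ∑ j ∈ range nb, (D i j : ℂ) * C j i' = if i = i' then 1 else 0 := by
    intro i hi i' hi'
    have h := c.of_checkDC p hDC (Finset.mem_range.1 hi) (Finset.mem_range.1 hi')
    rw [hD, hC]
    simp only
    have e : ∑ j ∈ range nb, (((getM (c.Db p) i j : ℚ) : ℝ) : ℂ) * (((getM (c.Cb p) j i' : ℚ) : ℝ) : ℂ)
        = (((∑ j ∈ range c.nb, getM (c.Db p) i j * getM (c.Cb p) j i' : ℚ) : ℝ) : ℂ) := by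
      push_cast; rfl
    rw [e, h]
    push_cast
    split_ifs <;> simp
  have hret : ∀ i ∈ range nb, M (2 * i + p) = ∑ j ∈ range nb, (D i j : ℂ) * y j := by
    intro i hi
    rw [hy]
    unfold yVec
    rw [← hnb]
    have := WeilAlg.lin_retract nb D C (fun i' ↦ M (2 * i' + p)) hDC' hi
    rw [hC] at this
    simp only at this
    rw [← this]
    rfl
  -- (2) the `P_r` term
  have hP : ∑ i ∈ range nb, ∑ i' ∈ range nb,
      (P (2 * i + p) (2 * i' + p) : ℂ) * (conj (M (2 * i + p)) * M (2 * i' + p)) =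
      ∑ j ∈ range nb, ∑ j' ∈ range nb,
        (∑ i ∈ range nb, ∑ i' ∈ range nb,
          (D i j : ℂ) * (P (2 * i + p) (2 * i' + p) : ℂ) * D i' j') * (conj (y j) * y j') := by
    rw [← WeilAlg.quad_transform nb nb]
    refine Finset.sum_congr rfl fun i hi ↦ Finset.sum_congr rfl fun i' hi' ↦ ?_
    rw [hret i hi, hret i' hi']
  -- (3) the `u`-terms
  have hu : ∀ i, c.uVec M (2 * i + p) = ∑ j ∈ range nb, ((C j i * b j : ℝ) : ℂ) * y j := by
    intro i
    rw [uVec_block M p i hp, hC, hb, hy, ← hnb]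
    refine Finset.sum_congr rfl fun j _ ↦ ?_
    push_cast
    rfl
  have hu1 : 2 * ∑ i ∈ range nb, conj (c.uVec M (2 * i + p)) * M (2 * i + p) =
      ∑ j ∈ range nb, ∑ j' ∈ range nb,
        ((if j = j' then 2 * b j else 0 : ℝ) : ℂ) * (conj (y j) * y j') := by
    have e1 : ∀ i ∈ range nb, conj (c.uVec M (2 * i + p)) * M (2 * i + p) =
        ∑ j ∈ range nb, (b j : ℂ) * conj (y j) * ((C j i : ℂ) * M (2 * i + p)) := by
      intro i _
      rw [hu i, map_sum, Finset.sum_mul]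
      refine Finset.sum_congr rfl fun j _ ↦ ?_
      rw [map_mul, Complex.conj_ofReal]
      push_cast
      ring
    rw [Finset.sum_congr rfl e1, Finset.sum_comm]
    have e2 : ∀ j ∈ range nb, ∑ i ∈ range nb, (b j : ℂ) * conj (y j) * ((C j i : ℂ) * M (2 * i + p)) =
        (b j : ℂ) * conj (y j) * y j := by
      intro j _
      rw [← Finset.mul_sum]
      congr 1
    rw [Finset.sum_congr rfl e2, Finset.mul_sum]
    refine Finset.sum_congr rfl fun j hj ↦ ?_
    have e3 : ∀ j' ∈ range nb, ((if j = j' then 2 * b j else 0 : ℝ) : ℂ) * (conj (y j) * y j') =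
        if j = j' then (2 * b j : ℂ) * (conj (y j) * y j') else 0 := by
      intro j' _
      split_ifs
      · push_cast; ring
      · simp
    rw [Finset.sum_congr rfl e3, Finset.sum_ite_eq, if_pos hj]
    ring
  have hu2 : ∑ i ∈ range nb, ∑ i' ∈ range nb,
      conj (c.uVec M (2 * i + p)) * c.uVec M (2 * i' + p) * (c.hBlkQ p i i' : ℂ) =
      ∑ j ∈ range nb, ∑ j' ∈ range nb,
        (∑ i ∈ range nb, ∑ i' ∈ range nb,
          ((C j i * b j : ℝ) : ℂ) * (c.hBlkQ p i i' : ℂ) * ((C j' i' * b j' : ℝ) : ℂ)) *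
          (conj (y j) * y j') := by
    rw [← WeilAlg.quad_transform nb nb (fun i i' ↦ (c.hBlkQ p i i' : ℂ)) (fun i j ↦ C j i * b j) y]
    refine Finset.sum_congr rfl fun i _ ↦ Finset.sum_congr rfl fun i' _ ↦ ?_
    rw [hu i, hu i']
    ring
  rw [hP, hu1, hu2, mul_sub, Finset.mul_sum, Finset.mul_sum, ← Finset.sum_sub_distrib,
    ← Finset.sum_add_distrib]
  refine Finset.sum_congr rfl fun j hj ↦ ?_
  rw [Finset.mul_sum, Finset.mul_sum, ← Finset.sum_sub_distrib, ← Finset.sum_add_distrib]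
  refine Finset.sum_congr rfl fun j' hj' ↦ ?_
  -- entry identity
  have hS := c.getM_spBlkP P p κ (Finset.mem_range.1 hj) (Finset.mem_range.1 hj')
  have hH := c.getM_hpBlk p (Finset.mem_range.1 hj) (Finset.mem_range.1 hj')
  rw [spFunP, hS]
  have eP : ∑ i ∈ range nb, ∑ i' ∈ range nb,
      (D i j : ℂ) * (P (2 * i + p) (2 * i' + p) : ℂ) * D i' j' =
      (((∑ k ∈ range c.nb, getM (c.Db p) k j *
        ∑ l ∈ range c.nb, P (2 * k + p) (2 * l + p) * getM (c.Db p) l j' : ℚ) : ℝ) : ℂ) := by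
    rw [hD]
    push_cast
    rw [← hnb]
    refine Finset.sum_congr rfl fun i _ ↦ ?_
    rw [Finset.mul_sum]
    refine Finset.sum_congr rfl fun i' _ ↦ ?_
    ring
  have eH : ∑ i ∈ range nb, ∑ i' ∈ range nb,
      ((C j i * b j : ℝ) : ℂ) * (c.hBlkQ p i i' : ℂ) * ((C j' i' * b j' : ℝ) : ℂ) =
      (b j : ℂ) * b j' * (((getM (c.hpBlk p) j j' : ℚ) : ℝ) : ℂ) := by
    rw [hH, hC, hb]
    push_cast
    rw [← hnb, Finset.mul_sum, Finset.sum_comm]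
    refine Finset.sum_congr rfl fun i' _ ↦ ?_
    rw [Finset.sum_mul, Finset.mul_sum]
    refine Finset.sum_congr rfl fun i _ ↦ ?_
    ring
  rw [eP, eH, hb]
  split_ifs <;> push_cast <;> ring

/-- **The algebraic core.** With `N + 1 = 2 nb`, both blocks checked and `κ ≥ 0`... (κ sign not
needed here): the reduced form plus `κ ×` the Bessel expression is `Σ_p Re y_p* S'_p y_p ≥ 0`. [folklore] -/
theorem core_nonnegP {P : ℕ → ℕ → ℚ} {κ : ℚ} (hN : c.N + 1 = 2 * c.nb)
    (hPcross : ∀ {k l : ℕ}, k % 2 ≠ l % 2 → P k l = 0) (hb0 : c.checkBlockP P κ 0 = true)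
    (hb1 : c.checkBlockP P κ 1 = true) (a : ℝ) (ha : (c.a0 : ℝ) = a) (M : ℕ → ℂ) :
    0 ≤ (∑ k ∈ range (c.N + 1), ∑ l ∈ range (c.N + 1),
        (P k l : ℝ) * (conj (M k) * M l).re) +
      (κ : ℝ) *
        (2 * (∑ k ∈ range (c.N + 1), conj (c.uVec M k) * M k).re -
          (∑ k ∈ range (c.N + 1), ∑ l ∈ range (c.N + 1),
            conj (c.uVec M k) * c.uVec M l * (gramH a k l : ℂ)).re) := by
  have hDC0 : c.checkDC 0 = true := by
    unfold checkBlockP at hb0; rw [Bool.and_eq_true] at hb0; exact hb0.1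
  have hDC1 : c.checkDC 1 = true := by
    unfold checkBlockP at hb1; rw [Bool.and_eq_true] at hb1; exact hb1.1
  -- rewrite everything as the real part of one complex expression
  have key : (∑ k ∈ range (c.N + 1), ∑ l ∈ range (c.N + 1),
        (P k l : ℝ) * (conj (M k) * M l).re) +
      (κ : ℝ) *
        (2 * (∑ k ∈ range (c.N + 1), conj (c.uVec M k) * M k).re -
          (∑ k ∈ range (c.N + 1), ∑ l ∈ range (c.N + 1),
            conj (c.uVec M k) * c.uVec M l * (gramH a k l : ℂ)).re) =
      ((∑ k ∈ range (c.N + 1), ∑ l ∈ range (c.N + 1),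
          (P k l : ℂ) * (conj (M k) * M l)) +
        (κ : ℂ) *
          (2 * ∑ k ∈ range (c.N + 1), conj (c.uVec M k) * M k -
            ∑ k ∈ range (c.N + 1), ∑ l ∈ range (c.N + 1),
              conj (c.uVec M k) * c.uVec M l * (gramH a k l : ℂ))).re := by
    have e1 : (∑ k ∈ range (c.N + 1), ∑ l ∈ range (c.N + 1),
        (P k l : ℂ) * (conj (M k) * M l)).re =
        ∑ k ∈ range (c.N + 1), ∑ l ∈ range (c.N + 1), (P k l : ℝ) * (conj (M k) * M l).re := by
      rw [Complex.re_sum]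
      refine Finset.sum_congr rfl fun k _ ↦ ?_
      rw [Complex.re_sum]
      refine Finset.sum_congr rfl fun l _ ↦ ?_
      rw [show ((P k l : ℚ) : ℂ) = (((P k l : ℚ) : ℝ) : ℂ) by norm_cast,
        Complex.re_ofReal_mul]
    have e2 : ∀ (κ : ℚ) (X Y : ℂ), ((κ : ℂ) * (2 * X - Y)).re = (κ : ℝ) * (2 * X.re - Y.re) := by
      intro κ X Y
      rw [show ((κ : ℚ) : ℂ) = (((κ : ℚ) : ℝ) : ℂ) by norm_cast, Complex.re_ofReal_mul]
      congr 1
      simp [Complex.mul_re]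
    rw [Complex.add_re, e1, e2]
  rw [key]
  -- parity split
  have hH : ∀ k l, k % 2 ≠ l % 2 → (gramH a k l : ℂ) = 0 := by
    intro k l hkl
    have hodd : Odd (k + l) := by
      rcases Nat.even_or_odd k with hk | hk <;> rcases Nat.even_or_odd l with hl | hl
      · exact absurd (by rw [Nat.even_iff.1 hk, Nat.even_iff.1 hl]) hkl
      · exact hk.add_odd hl
      · exact hk.add_even hl
      · exact absurd (by rw [Nat.odd_iff.1 hk, Nat.odd_iff.1 hl]) hkl
    rw [gramH, hodd.neg_one_pow]
    simp
  rw [hN, WeilAlg.sum_sum_range_two_mul c.nb _ (fun k l hkl ↦ by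
      rw [hPcross hkl]; simp),
    WeilAlg.sum_range_two_mul c.nb,
    WeilAlg.sum_sum_range_two_mul c.nb _ (fun k l hkl ↦ by rw [hH k l hkl]; simp)]
  -- the Gram entries on the blocks
  have hG : ∀ p i i', p < 2 → (gramH a (2 * i + p) (2 * i' + p) : ℂ) = (c.hBlkQ p i i' : ℂ) := by
    intro p i i' hp
    have hev : Even (2 * i + p + (2 * i' + p)) := ⟨i + i' + p, by ring⟩
    rw [gramH, hev.neg_one_pow, hBlkQ, ← ha]
    push_cast
    ring
  have e0 := c.block_identityP (P := P) κ (p := 0) (by norm_num) hDC0 M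
  have e1 := c.block_identityP (P := P) κ (p := 1) (by norm_num) hDC1 M
  simp only [add_zero] at e0
  have hG0 : ∀ i i', (gramH a (2 * i) (2 * i') : ℂ) = (c.hBlkQ 0 i i' : ℂ) := fun i i' ↦ by
    simpa using hG 0 i i' (by norm_num)
  have hG1 : ∀ i i', (gramH a (2 * i + 1) (2 * i' + 1) : ℂ) = (c.hBlkQ 1 i i' : ℂ) := fun i i' ↦
    hG 1 i i' (by norm_num)
  simp_rw [hG0, hG1]
  have etot : (∑ i ∈ range c.nb, ∑ j ∈ range c.nb,
        (P (2 * i) (2 * j) : ℂ) * (conj (M (2 * i)) * M (2 * j)) +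
      ∑ i ∈ range c.nb, ∑ j ∈ range c.nb,
        (P (2 * i + 1) (2 * j + 1) : ℂ) * (conj (M (2 * i + 1)) * M (2 * j + 1))) +
      (κ : ℂ) *
        (2 * (∑ i ∈ range c.nb, conj (c.uVec M (2 * i)) * M (2 * i) +
            ∑ i ∈ range c.nb, conj (c.uVec M (2 * i + 1)) * M (2 * i + 1)) -
          (∑ i ∈ range c.nb, ∑ j ∈ range c.nb,
              conj (c.uVec M (2 * i)) * c.uVec M (2 * j) * (c.hBlkQ 0 i j : ℂ) +
            ∑ i ∈ range c.nb, ∑ j ∈ range c.nb,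
              conj (c.uVec M (2 * i + 1)) * c.uVec M (2 * j + 1) * (c.hBlkQ 1 i j : ℂ))) =
      (∑ j ∈ range c.nb, ∑ j' ∈ range c.nb,
        (spFunP c P κ 0 j j' : ℂ) * (conj (c.yVec M 0 j) * c.yVec M 0 j')) +
      ∑ j ∈ range c.nb, ∑ j' ∈ range c.nb,
        (spFunP c P κ 1 j j' : ℂ) * (conj (c.yVec M 1 j) * c.yVec M 1 j') := by
    rw [← e0, ← e1]
    ring
  rw [etot, Complex.add_re]
  exact add_nonneg
    (WeilAlg.re_herm_nonneg c.nb _ (fun x ↦ c.spFunP_quad_nonneg hb0 x) _)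
    (WeilAlg.re_herm_nonneg c.nb _ (fun x ↦ c.spFunP_quad_nonneg hb1 x) _)






end WeilCert

/-! ## Rank-one (deflation) terms -/

/-- The parity-masked coefficient vector of a rank-one term `(μ, q, c)`: `ĉ_k = c_k` if `k ≡ q (mod 2)`, else `0`. [folklore] -/
def maskV (r : ℚ × ℕ × List ℚ) (k : ℕ) : ℚ := if k % 2 = r.2.1 % 2 then getV r.2.2 k else 0

/-- The coefficient matrix `Σ_i μ_i ĉ_{ik} ĉ_{il}` of the rank-one terms `Σ_i μ_i |Σ_k ĉ_{ik} M_k|²`. [folklore] -/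
def rankOneQ (R : List (ℚ × ℕ × List ℚ)) (k l : ℕ) : ℚ := (R.map fun r ↦ r.1 * maskV r k * maskV r l).sum

/-- The rank-one matrix is parity-diagonal. [folklore] -/
theorem rankOneQ_cross (R : List (ℚ × ℕ × List ℚ)) {k l : ℕ} (h : k % 2 ≠ l % 2) : rankOneQ R k l = 0 := by
  unfold rankOneQ
  induction R with
  | nil => simp
  | cons r R ih =>
    simp only [List.map_cons, List.sum_cons, ih, add_zero]
    unfold maskV
    by_cases hk : k % 2 = r.2.1 % 2
    · have hl : ¬ (l % 2 = r.2.1 % 2) := fun hl ↦ h (hk.trans hl.symm)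
      rw [if_neg hl, mul_zero]
    · rw [if_neg hk, mul_zero, zero_mul]

/-- `|Σ_k ĉ_k M_k|² = Σ_{k,l} ĉ_k ĉ_l Re(M̄_k M_l)` for a real coefficient vector. [folklore] -/
theorem norm_sq_sum_real_mul (n : ℕ) (a : ℕ → ℚ) (M : ℕ → ℂ) :
    ‖∑ k ∈ range n, ((a k : ℚ) : ℂ) * M k‖ ^ 2 =
      ∑ k ∈ range n, ∑ l ∈ range n, ((a k * a l : ℚ) : ℝ) * (conj (M k) * M l).re := by
  set Z : ℂ := ∑ k ∈ range n, ((a k : ℚ) : ℂ) * M k with hZ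
  have h1 : ‖Z‖ ^ 2 = (conj Z * Z).re := by
    rw [← Complex.normSq_eq_norm_sq, ← Complex.ofReal_re (Complex.normSq Z), Complex.normSq_eq_conj_mul_self]
  have hq : ∀ q : ℚ, ((q : ℚ) : ℂ) = (((q : ℚ) : ℝ) : ℂ) := fun q ↦ by push_cast; rfl
  rw [h1, hZ, map_sum, Finset.sum_mul, Complex.re_sum]
  refine Finset.sum_congr rfl fun k _ ↦ ?_
  rw [Finset.mul_sum, Complex.re_sum]
  refine Finset.sum_congr rfl fun l _ ↦ ?_
  rw [map_mul, hq (a k), hq (a l), Complex.conj_ofReal,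
    show ((((a k : ℚ) : ℝ) : ℂ)) * conj (M k) * ((((a l : ℚ) : ℝ) : ℂ) * M l) =
      (((a k * a l : ℚ) : ℝ) : ℂ) * (conj (M k) * M l) by push_cast; ring,
    Complex.re_ofReal_mul]

/-- The rank-one quadratic form: `Σ_{k,l} rankOneQ(k,l) Re(M̄_k M_l) = Σ_i μ_i |Σ_k ĉ_{ik} M_k|²`. [folklore] -/
theorem rankOneQ_quad (R : List (ℚ × ℕ × List ℚ)) (n : ℕ) (M : ℕ → ℂ) :
    ∑ k ∈ range n, ∑ l ∈ range n, ((rankOneQ R k l : ℚ) : ℝ) * (conj (M k) * M l).re =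
      (R.map fun r ↦ (r.1 : ℝ) * ‖∑ k ∈ range n, ((maskV r k : ℚ) : ℂ) * M k‖ ^ 2).sum := by
  induction R with
  | nil => simp [rankOneQ]
  | cons r R ih =>
    simp only [List.map_cons, List.sum_cons]
    rw [← ih]
    have e : ∀ k l, ((rankOneQ (r :: R) k l : ℚ) : ℝ) =
        (r.1 : ℝ) * ((maskV r k * maskV r l : ℚ) : ℝ) + ((rankOneQ R k l : ℚ) : ℝ) := by
      intro k l
      simp only [rankOneQ, List.map_cons, List.sum_cons]
      push_cast
      ring
    simp_rw [e, add_mul, Finset.sum_add_distrib]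
    congr 1
    rw [norm_sq_sum_real_mul, Finset.mul_sum]
    refine Finset.sum_congr rfl fun k _ ↦ ?_
    rw [Finset.mul_sum]
    refine Finset.sum_congr rfl fun l _ ↦ ?_
    ring

namespace WeilCert

variable {c : WeilCert}

/-- **The algebraic core with rank-one terms**: if both parity blocks of `P_r + Σ μ ĉ ĉᵀ` pass the check with Bessel weight
`κ'`, then `Σ P_r(k,l) Re(M̄_k M_l) + κ'·Bessel(M) + Σ_i μ_i |Σ_k ĉ_{ik} M_k|² ≥ 0` for every moment vector `M`. [folklore] -/
theorem core_nonnegR {nu : List ℚ} {κ : ℚ} (R : List (ℚ × ℕ × List ℚ)) (hN : c.N + 1 = 2 * c.nb)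
    (hb0 : c.checkBlockP (fun k l ↦ c.prQ nu k l + rankOneQ R k l) κ 0 = true)
    (hb1 : c.checkBlockP (fun k l ↦ c.prQ nu k l + rankOneQ R k l) κ 1 = true) (a : ℝ) (ha : (c.a0 : ℝ) = a)
    (M : ℕ → ℂ) :
    0 ≤ (∑ k ∈ range (c.N + 1), ∑ l ∈ range (c.N + 1), (c.prQ nu k l : ℝ) * (conj (M k) * M l).re) +
      (κ : ℝ) *
        (2 * (∑ k ∈ range (c.N + 1), conj (c.uVec M k) * M k).re -
          (∑ k ∈ range (c.N + 1), ∑ l ∈ range (c.N + 1),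
            conj (c.uVec M k) * c.uVec M l * (gramH a k l : ℂ)).re) +
      (R.map fun r ↦ (r.1 : ℝ) * ‖∑ k ∈ range (c.N + 1), ((maskV r k : ℚ) : ℂ) * M k‖ ^ 2).sum := by
  have hcross : ∀ {k l : ℕ}, k % 2 ≠ l % 2 → c.prQ nu k l + rankOneQ R k l = 0 := fun hkl ↦ by
    rw [c.prQ_cross nu hkl, rankOneQ_cross R hkl, add_zero]
  have h := core_nonnegP (P := fun k l ↦ c.prQ nu k l + rankOneQ R k l) hN hcross hb0 hb1 a ha M
  have e : ∑ k ∈ range (c.N + 1), ∑ l ∈ range (c.N + 1),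
      (((fun k l ↦ c.prQ nu k l + rankOneQ R k l) k l : ℚ) : ℝ) * (conj (M k) * M l).re =
      (∑ k ∈ range (c.N + 1), ∑ l ∈ range (c.N + 1), (c.prQ nu k l : ℝ) * (conj (M k) * M l).re) +
        ∑ k ∈ range (c.N + 1), ∑ l ∈ range (c.N + 1), ((rankOneQ R k l : ℚ) : ℝ) * (conj (M k) * M l).re := by
    rw [← Finset.sum_add_distrib]
    refine Finset.sum_congr rfl fun k _ ↦ ?_
    rw [← Finset.sum_add_distrib]
    refine Finset.sum_congr rfl fun l _ ↦ ?_
    push_cast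
    ring
  rw [e, rankOneQ_quad] at h
  linarith

end WeilCert

/-! ## The deflated two-prime certificate: checker and soundness -/

namespace WeilCert23

variable (c : WeilCert23)

/-- **The checker of the rank-one augmented certificate** for the claim `β‖g‖² ≤ E₂₃(g) + Σ μ|Σ ĉ M|²` on `C(b)`:
cells, scalars, moment table as in `check`; `β ≤ κ`; both blocks of `P_r + Σ μ ĉ ĉᵀ` with Bessel weight `κ − β`. [folklore] -/
def checkR (β : ℚ) (R : List (ℚ × ℕ × List ℚ)) : Bool :=
  checkCells₂₃ c.base.prec c.j c.base.wL c.base.T c.base.mwT c.cells && c.checkScalars && c.checkNu &&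
    decide (β ≤ c.kappaQ) &&
    c.base.checkBlockP (fun k l ↦ c.base.prQ c.nuTab k l + rankOneQ R k l) (c.kappaQ - β) 0 &&
    c.base.checkBlockP (fun k l ↦ c.base.prQ c.nuTab k l + rankOneQ R k l) (c.kappaQ - β) 1

variable {c}

/-- Unpacking `checkR`. [folklore] -/
theorem checkR_spec {β : ℚ} {R : List (ℚ × ℕ × List ℚ)} (h : c.checkR β R = true) :
    checkCells₂₃ c.base.prec c.j c.base.wL c.base.T c.base.mwT c.cells = true ∧
      c.checkScalars = true ∧ c.checkNu = true ∧ β ≤ c.kappaQ ∧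
      c.base.checkBlockP (fun k l ↦ c.base.prQ c.nuTab k l + rankOneQ R k l) (c.kappaQ - β) 0 = true ∧
      c.base.checkBlockP (fun k l ↦ c.base.prQ c.nuTab k l + rankOneQ R k l) (c.kappaQ - β) 1 = true := by
  unfold checkR at h
  simp only [Bool.and_eq_true, decide_eq_true_eq] at h
  exact ⟨h.1.1.1.1.1, h.1.1.1.1.2, h.1.1.1.2, h.1.1.2, h.1.2, h.2⟩

/-- **Soundness of the rank-one augmented (deflated) two-prime certificate.**  If `c.checkR β R = true` then for every test
function `g` supported in `[-b, b]`:
`β ‖g‖₂² ≤ E₂₃(g) + Σ_{(μ,q,c) ∈ R} μ |Σ_{k ≤ N} ĉ_k M_k(g)|²`, `M_k(g) = ∫ g(x)(x/a₀)^k dx`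
(for `b ≤ log 2`, `E₂₃(g) = Re W(g ⋆ g̃)` by `weilQuadratic_re_eq_weilTwoPrimeQuadratic`).  This is the complement
certificate `hcert` of the deflated Temple L-side with polynomial trial vectors `v_i = Σ_k ĉ_{ik}(x/a₀)^k` on the window.
[cite: Yoshida1992, Thm 1 (moment certificates)] -/
theorem weilTwoPrimeQuadratic_rankOne_bound_of_checkR {β : ℚ} {R : List (ℚ × ℕ × List ℚ)} (h : c.checkR β R = true)
    {g : ℝ → ℂ} (hg : IsWeilTest g) (hsupp : tsupport g ⊆ Icc (-(c.b : ℝ)) c.b) :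
    (β : ℝ) * weilNorm2Sq g ≤ weilTwoPrimeQuadratic g +
      (R.map fun r ↦ (r.1 : ℝ) * ‖∑ k ∈ range (c.base.N + 1),
        ((maskV r k : ℚ) : ℂ) * weilMoment c.base.a0 g k‖ ^ 2).sum := by
  obtain ⟨hcells3, hsc, hnuchk, hβ, hb0, hb1⟩ := checkR_spec h
  obtain ⟨-, hbpos, hba, -, -, -, -, hN, -⟩ := scalars_spec hsc
  have hb0' : (0 : ℝ) < c.b := by exact_mod_cast hbpos
  have hba' : ((c.b : ℚ) : ℝ) ≤ (c.base.a0 : ℝ) := by exact_mod_cast hba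
  have ha : (0 : ℝ) < (c.base.a0 : ℝ) := by linarith
  have hsupp' : tsupport g ⊆ Icc (-(c.base.a0 : ℝ)) c.base.a0 := hsupp.trans (Icc_subset_Icc (by linarith) hba')
  have step3 := margin_step3 hcells3 hsc hnuchk hg hsupp
  have hbes := weilNorm2Sq_ge_bessel hg ha hsupp' (c.base.N + 1) (c.base.uVec (weilMoment c.base.a0 g))
  have hcore := WeilCert.core_nonnegR (c := c.base) (nu := c.nuTab) (κ := c.kappaQ - β) R hN hb0 hb1 _ rfl
    (weilMoment c.base.a0 g)
  have hκ' : (0 : ℝ) ≤ ((c.kappaQ - β : ℚ) : ℝ) := by exact_mod_cast sub_nonneg.2 hβ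
  have h4 := mul_le_mul_of_nonneg_left hbes hκ'
  push_cast at hcore h4 ⊢
  nlinarith [step3, hcore, h4]

end WeilCert23

end Literature.NumberTheory.LFunctions

end
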